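import Summits.QuantumFields.BalabanUV.Beta.GAN24.VHClassCurrentSym

/-!
# `BalabanUV.Beta.GAN24.FaceDataHessNull` — binder row G-an2-4, crossed-ledger telescopy (γ) hand, letter K7-a (VH half): **THE ROOTED HESSIAN KERNEL — an1's
# ADDITIVE-CHART BORDER LETTER `vhSaddAt` — VANISHES AGAINST TWO FACE-SUPPORTED SINGLE-COORDINATE DATA**, for every free leg, every `d`, every in-block root.

NOT IN PRINT; OUR BOOKKEEPING ([folklore] finite combinatorics over an1's DEFINITIONS BY NAME: `AveragingContours.seg ∕ segUp ∕ segDown ∕ axial ∕ axialAux ∕ corner ∕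
rev`, `AveragingContoursRooted.gammaCAt ∕ loopCAt`, `AveragingHessianKernels.δ1 ∕ wedge ∕ wedge_eq_zero_of_fst ∕ mem_segUp ∕ mem_segDown ∕ corner_apply_or ∕ Near ∕
packVH_inl_inr`, `AveragingHessianKernelsRooted.hessCountAt ∕ linCountAt ∕ cCountAt ∕ hessKerAt ∕ hessKerAt_swap ∕ hessKerAt_eq_zero_left ∕ _right ∕ vhSaddAt ∕
vhSaddAt_symm`, `TransportedContourVariables.pairForm`, and leaf-04's `GAN24.VHClassCurrentSym.emod_window`, `LinearGaugeVH.nearBox`; G-an2-4 formalisation swarm, leaf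
prover `b2b-balaban-gan24-formalise-leaf-06`, gen 56).  HONEST FRAMING (cell contract): «discharging `BetaPertH` makes Bałaban's UV stability UNCONDITIONAL — a
real constructive-QFT result; it is NOT the continuum limit and NOT the Clay problem» (verbatim): «continuum YM on T⁴ ⇐ BetaPertH ∧ nine spine estimates (0/9
proved); BetaPertH ⇐ (D1) ∧ (D4) ∧ CAP+tail; G-an2-4 gates asym, D1 and NE2».

WHY.  With `GAN24.FaceDataVHChart` (the product-chart letter `vhSAt` against face data on both legs IS its additive-chart part `vhSaddAt`), this file finishes the
UNSYMMETRISED VH null `Θ^{νβ}_m ≡ 0` behind the (γ) hand's face∕cell reads: the E⊗VH and VH⊗E face words of the E-frame forcing die for a STRUCTURAL reason, a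
finite fact about an1's rooted contours, not a numerical accident (ENGINE, weight 0: `|Θ| ≤ 3·10⁻¹⁵` in D = 2 and D = 3, this lineage's gen-56 kits j222823, j224036).
THE MECHANISM.  an1's `LettersIn` remembers only the base point of a letter's bond; the null needs the DIRECTION: along `Γ^ρ_{c,x}` = in-block axial path ++
straight `L`-segment ++ in-block return path (and the straight coarse bond), a letter in direction `κ` has base coordinate `x′_κ` STRICTLY BELOW the top of its
segment, hence `x′_κ ≤ L·y_κ + L − 2 + L·[κ = μ]` (§1, the region `(fun (κ : Fin _) (x' : Fin _ → ℤ) => x' κ ≤ (L : ℤ) * y κ + ((L : ℤ) - 2) + (if κ = μ then (L : ℤ) else 0))`): transverse bonds never reach a block face, `μ`-bonds never reach the far face of the support box.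
So `h^ρ_{(μ,y)}(f, f′) = 0` as soon as one bond is a face bond off that region (§2), i.e. for every face bond except the `μ`-bonds at the near face height
`L·y_μ + L − 1`; face-supported single-coordinate data therefore see only `β = ν = μ` at that one height, where the weights are the constants `h(H)·s(H)` and the
kernel is summed over a SQUARE — zero by antisymmetry (`hessKerAt_swap`) (§3).  §4 unpacks an1's packer for every free leg (field free legs: no ff block;
multiplier free leg `(p, inr m)`, `p` coarse).

WHAT ([folklore]; generic `d`, `1 ≤ L`, in-block root `r ∈ box L`; three LOCAL NOTATIONS `(∀ a ∈ l, ∃ κ₀ x₀, P κ₀ x₀ ∧ (a = A κ₀ x₀ ∨ a = -A κ₀ x₀))` (direction-aware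
`LettersIn`), `(fun (κ : Fin d) (x' : Fin d → ℤ) => (∀ i, min (y i) (x i) ≤ x' i ∧ x' i ≤ max (y i) (x i)) ∧ x' κ < max (y κ) (x κ))`, `(fun (κ : Fin _) (x' : Fin _ → ℤ) => x' κ ≤ (L : ℤ) * y κ + ((L : ℤ) - 2) + (if κ = μ then (L : ℤ) else 0))` and NO definition, 0 cited facts, 0 `def … : Prop`, 0 sorry): §1 `lettersInB_seg ∕ _axialAux ∕ _axial ∕ _gammaCAt ∕ _cSegAt ∕ _loopCAt`; §2 `sum_eq_zero_of_lettersInB`,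
`fst_eq_zero_of_lettersInB`, `linCountAt_eq_zero_of_not_inSupp`, `cCountAt_eq_zero_of_not_inSupp`, **`hessCountAt_eq_zero_of_not_inSupp_left ∕ _right`**,
`hessKerAt_eq_zero_of_not_inSupp_left ∕ _right`, `sum_sum_hessKerAt_eq_zero`; §3 `face_heights`, **`sum_nearBox_faceData_hessKerAt_eq_zero`**; §4
**`vhSaddAt_faceData_eq_zero`** ∕ `…'`: `Σ'_q h(q_β)·Σ'_u s(u_ν)·vhSaddAt ρ d L ν u q p (inl β) a = 0`.  With `FaceDataVHChart.vhSAt_faceData_eq_vhSaddAt` the same holds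
for `vhSAt` (combined in `GAN24.FaceDataVHNull` once the chart file is built on the farm).  Asserts NO value of Bałaban's tables beyond an1's DEFINED kernels; NOT
(VAL-l), NOT «hXu», NOT D1, NOT `BetaPertH`, NOT continuum, NOT Clay.
-/

noncomputable section

open Finset
open scoped BigOperators
open Literature.MathematicalPhysics.QuantumFieldTheory.Balaban1983to89
open Literature.MathematicalPhysics.QuantumFieldTheory.Balaban1983to89.Beta
open AffineAveraging AveragingContours AveragingContoursRooted AveragingHessianKernels AveragingHessianKernelsRooted
open TransportedContourVariables (pairForm pairForm_apply)
open OneStepResolventKernel (Fib)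
open Summit.QuantumFields.BalabanUV.Beta.LinearGaugeVH (nearBox mem_nearBox)

namespace Summit.QuantumFields.BalabanUV.Beta.GAN24.FaceDataHessNull

variable {d : ℕ}

/-! ## §1 Direction-aware letter support: the moving coordinate of every letter stays strictly below the top of its segment -/

section Letters

variable {R : Type*} [AddCommGroup R]

/-- [folklore] The empty list. -/
theorem lettersInB_nil (A : Form1 d R) (P : Fin d → (Fin d → ℤ) → Prop) : (∀ a ∈ ([] : List R), ∃ κ₀ x₀, P κ₀ x₀ ∧ (a = A κ₀ x₀ ∨ a = -A κ₀ x₀)) := fun a ha => by simp at ha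

/-- [folklore] Monotonicity of the letter support in the bond region. -/
theorem lettersInB_mono {A : Form1 d R} {P Q : Fin d → (Fin d → ℤ) → Prop} (hPQ : ∀ κ x, P κ x → Q κ x) {l : List R}
    (h : (∀ a ∈ l, ∃ κ₀ x₀, P κ₀ x₀ ∧ (a = A κ₀ x₀ ∨ a = -A κ₀ x₀))) : (∀ a ∈ l, ∃ κ₀ x₀, Q κ₀ x₀ ∧ (a = A κ₀ x₀ ∨ a = -A κ₀ x₀)) := fun a ha => by
  obtain ⟨κ, x, hx, h⟩ := h a ha
  exact ⟨κ, x, hPQ κ x hx, h⟩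

/-- [folklore] Letter support is stable under concatenation. -/
theorem lettersInB_append {A : Form1 d R} {P : Fin d → (Fin d → ℤ) → Prop} {l₁ l₂ : List R} (h₁ : (∀ a ∈ l₁, ∃ κ₀ x₀, P κ₀ x₀ ∧ (a = A κ₀ x₀ ∨ a = -A κ₀ x₀)))
    (h₂ : (∀ a ∈ l₂, ∃ κ₀ x₀, P κ₀ x₀ ∧ (a = A κ₀ x₀ ∨ a = -A κ₀ x₀))) : (∀ a ∈ l₁ ++ l₂, ∃ κ₀ x₀, P κ₀ x₀ ∧ (a = A κ₀ x₀ ∨ a = -A κ₀ x₀)) := fun a ha => by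
  rcases List.mem_append.1 ha with h | h
  exacts [h₁ a h, h₂ a h]

/-- [folklore] Letter support is stable under `rev` (letters negated and reversed). -/
theorem lettersInB_rev {A : Form1 d R} {P : Fin d → (Fin d → ℤ) → Prop} {l : List R} (h : (∀ a ∈ l, ∃ κ₀ x₀, P κ₀ x₀ ∧ (a = A κ₀ x₀ ∨ a = -A κ₀ x₀))) :
    (∀ a ∈ rev l, ∃ κ₀ x₀, P κ₀ x₀ ∧ (a = A κ₀ x₀ ∨ a = -A κ₀ x₀)) := by
  intro a ha
  unfold AveragingContours.rev at ha
  rw [List.mem_reverse] at ha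
  obtain ⟨b, hb, rfl⟩ := List.mem_map.1 ha
  obtain ⟨κ, x, hx, h⟩ := h b hb
  refine ⟨κ, x, hx, ?_⟩
  rcases h with h | h
  · right; rw [h]
  · left; rw [h, neg_neg]

/-- [folklore] THE MOVING COORDINATE OF A SEGMENT LETTER IS STRICTLY BELOW THE TOP: every letter of `seg A z κ n` is `± A κ x′` with `x′_i = z_i` (`i ≠ κ`) and
`min(z_κ, z_κ + n) ≤ x′_κ < max(z_κ, z_κ + n)`. -/
theorem lettersInB_seg (A : Form1 d R) (z : Fin d → ℤ) (κ : Fin d) (n : ℤ) :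
    (∀ a ∈ seg A z κ n, ∃ κ₀ x₀, (fun κ' x' => κ' = κ ∧ (∀ i, i ≠ κ → x' i = z i) ∧ min (z κ) (z κ + n) ≤ x' κ ∧ x' κ < max (z κ) (z κ + n)) κ₀ x₀ ∧ (a = A κ₀ x₀ ∨ a = -A κ₀ x₀)) := by
  intro a ha
  unfold seg at ha
  split_ifs at ha with hn
  · obtain ⟨s, hs', rfl⟩ := mem_segUp ha
    have hsn : (s : ℤ) < n := by have := Int.toNat_of_nonneg hn; omega
    refine ⟨κ, _, ⟨rfl, fun i hi => ?_, ?_, ?_⟩, Or.inl rfl⟩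
    · simp only [Pi.add_apply, Pi.smul_apply, unitVec_apply, smul_eq_mul, if_neg hi, mul_zero, add_zero]
    · simp only [Pi.add_apply, Pi.smul_apply, unitVec_apply, smul_eq_mul, if_true, mul_one]
      exact min_le_iff.2 (Or.inl (by omega))
    · simp only [Pi.add_apply, Pi.smul_apply, unitVec_apply, smul_eq_mul, if_true, mul_one]
      exact lt_max_iff.2 (Or.inr (by omega))
  · obtain ⟨s, hs', rfl⟩ := mem_segDown ha
    have hsn : (s : ℤ) < -n := by have := Int.toNat_of_nonneg (by omega : (0 : ℤ) ≤ -n); omega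
    refine ⟨κ, _, ⟨rfl, fun i hi => ?_, ?_, ?_⟩, Or.inr rfl⟩
    · simp only [Pi.sub_apply, Pi.smul_apply, unitVec_apply, smul_eq_mul, if_neg hi, mul_zero, sub_zero]
    · simp only [Pi.sub_apply, Pi.smul_apply, unitVec_apply, smul_eq_mul, if_true, mul_one]
      exact min_le_iff.2 (Or.inr (by omega))
    · simp only [Pi.sub_apply, Pi.smul_apply, unitVec_apply, smul_eq_mul, if_true, mul_one]
      exact lt_max_iff.2 (Or.inl (by omega))

/-- [folklore] The letters of the axial contour pieces lie in the region `AxB`. -/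
theorem lettersInB_axialAux (A : Form1 d R) (y x : Fin d → ℤ) : ∀ m, (∀ a ∈ axialAux A y x m, ∃ κ₀ x₀, ((fun (κ : Fin d) (x' : Fin d → ℤ) => (∀ i, min (y i) (x i) ≤ x' i ∧ x' i ≤ max (y i) (x i)) ∧ x' κ < max (y κ) (x κ))) κ₀ x₀ ∧ (a = A κ₀ x₀ ∨ a = -A κ₀ x₀))
  | 0 => lettersInB_nil A _
  | m + 1 => by
    refine lettersInB_append ?_ (lettersInB_axialAux A y x m)
    split_ifs with h
    · have hs := lettersInB_seg A (corner y x (m + 1)) ⟨m, h⟩ (x ⟨m, h⟩ - y ⟨m, h⟩)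
      refine lettersInB_mono (fun κ' x' hx' => ?_) hs
      beta_reduce at hx' ⊢
      obtain ⟨rfl, hoth, hlo, hhi⟩ := hx'
      have hc : corner y x (m + 1) ⟨m, h⟩ = y ⟨m, h⟩ := by simp [corner]
      rw [hc, add_sub_cancel] at hlo hhi
      refine ⟨fun i => ?_, hhi⟩
      by_cases hi : i = (⟨m, h⟩ : Fin d)
      · subst hi; exact ⟨hlo, hhi.le⟩
      · rw [hoth i hi]
        rcases corner_apply_or y x (m + 1) i with e | e <;> rw [e]
        · exact ⟨min_le_left _ _, le_max_left _ _⟩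
        · exact ⟨min_le_right _ _, le_max_right _ _⟩
    · exact lettersInB_nil A _

/-- [folklore] The letters of `Γ_{y,x}` lie in the region `AxB`. -/
theorem lettersInB_axial (A : Form1 d R) (y x : Fin d → ℤ) : (∀ a ∈ axial A y x, ∃ κ₀ x₀, ((fun (κ : Fin d) (x' : Fin d → ℤ) => (∀ i, min (y i) (x i) ≤ x' i ∧ x' i ≤ max (y i) (x i)) ∧ x' κ < max (y κ) (x κ))) κ₀ x₀ ∧ (a = A κ₀ x₀ ∨ a = -A κ₀ x₀)) :=
  lettersInB_axialAux A y x d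

/-- [folklore] Every letter of `Γ^ρ_{c,x}` (root offset and endpoint offset in the box) lies in the sharp support region. -/
theorem lettersInB_gammaCAt (A : Form1 d R) (L : ℕ) (μ : Fin d) (y : Fin d → ℤ) {r b : Fin d → ℕ}
    (hr : r ∈ box d L) (hb : b ∈ box d L) : (∀ a ∈ gammaCAt (toSite r) A L μ y b, ∃ κ₀ x₀, ((fun (κ : Fin _) (x' : Fin _ → ℤ) => x' κ ≤ (L : ℤ) * y κ + ((L : ℤ) - 2) + (if κ = μ then (L : ℤ) else 0))) κ₀ x₀ ∧ (a = A κ₀ x₀ ∨ a = -A κ₀ x₀)) := by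
  have hr' : ∀ i, r i < L := by simpa [AffineAveraging.box, Fintype.mem_piFinset, Finset.mem_range] using hr
  have hb' : ∀ i, b i < L := by simpa [AffineAveraging.box, Fintype.mem_piFinset, Finset.mem_range] using hb
  refine lettersInB_append (lettersInB_append ?_ ?_) ?_
  · refine lettersInB_mono (fun κ x' hx' => ?_) (lettersInB_axial A _ _)
    beta_reduce at hx' ⊢
    have h2 := hx'.2
    have hi := hb' κ; have hri := hr' κ
    simp only [Pi.add_apply, Pi.smul_apply, smul_eq_mul, toSite] at h2
    rw [lt_max_iff] at h2
    split_ifs <;> omega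
  · intro a ha
    obtain ⟨s, hs', rfl⟩ := mem_segUp ha
    refine ⟨μ, _, ?_, Or.inl rfl⟩
    have hi := hb' μ
    simp only [Pi.add_apply, Pi.smul_apply, smul_eq_mul, toSite, unitVec_apply, if_true, mul_one]
    omega
  · refine lettersInB_mono (fun κ x' hx' => ?_) (lettersInB_rev (lettersInB_axial A _ _))
    beta_reduce at hx' ⊢
    have h2 := hx'.2
    have hi := hb' κ; have hri := hr' κ
    simp only [Pi.add_apply, Pi.smul_apply, smul_eq_mul, toSite, unitVec_apply] at h2
    rw [lt_max_iff] at h2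
    split_ifs at h2 ⊢ <;> omega

/-- [folklore] Every letter of the straight coarse bond from an in-block root lies in the sharp support region. -/
theorem lettersInB_cSegAt (A : Form1 d R) (L : ℕ) (μ : Fin d) (y : Fin d → ℤ) {r : Fin d → ℕ} (hr : r ∈ box d L) :
    (∀ a ∈ segUp A ((L : ℤ) • y + toSite r) μ L, ∃ κ₀ x₀, ((fun (κ : Fin _) (x' : Fin _ → ℤ) => x' κ ≤ (L : ℤ) * y κ + ((L : ℤ) - 2) + (if κ = μ then (L : ℤ) else 0))) κ₀ x₀ ∧ (a = A κ₀ x₀ ∨ a = -A κ₀ x₀)) := by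
  have hr' : ∀ i, r i < L := by simpa [AffineAveraging.box, Fintype.mem_piFinset, Finset.mem_range] using hr
  intro a ha
  obtain ⟨s, hs', rfl⟩ := mem_segUp ha
  refine ⟨μ, _, ?_, Or.inl rfl⟩
  have hri := hr' μ
  beta_reduce
  simp only [Pi.add_apply, Pi.smul_apply, smul_eq_mul, toSite, unitVec_apply, if_true, mul_one]
  omega

/-- [folklore] Every letter of the rooted closed loop lies in the sharp support region. -/
theorem lettersInB_loopCAt (A : Form1 d R) (L : ℕ) (μ : Fin d) (y : Fin d → ℤ) {r b : Fin d → ℕ}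
    (hr : r ∈ box d L) (hb : b ∈ box d L) : (∀ a ∈ loopCAt (toSite r) A L μ y b, ∃ κ₀ x₀, ((fun (κ : Fin _) (x' : Fin _ → ℤ) => x' κ ≤ (L : ℤ) * y κ + ((L : ℤ) - 2) + (if κ = μ then (L : ℤ) else 0))) κ₀ x₀ ∧ (a = A κ₀ x₀ ∨ a = -A κ₀ x₀)) :=
  lettersInB_append (lettersInB_gammaCAt A L μ y hr hb) (lettersInB_rev (lettersInB_cSegAt A L μ y hr))

end Letters

/-! ## §2 The rooted Hessian kernel off the sharp region, and on a symmetric square -/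

section Kernel

/-- [folklore] An indicator form of a bond outside the bond region has letter sum `0` on a list living in the region. -/
theorem sum_eq_zero_of_lettersInB {P : Fin d → (Fin d → ℤ) → Prop} {f : Bond d} (hf : ¬ P f.1 f.2) {l : List ℤ}
    (h : (∀ a ∈ l, ∃ κ₀ x₀, P κ₀ x₀ ∧ (a = (δ1 f) κ₀ x₀ ∨ a = -(δ1 f) κ₀ x₀))) : l.sum = 0 := by
  refine List.sum_eq_zero fun a ha => ?_
  obtain ⟨κ, x, hx, ha⟩ := h a ha
  have h0 : δ1 f κ x = 0 := by
    rw [δ1_apply, if_neg]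
    rintro rfl
    exact hf hx
  rcases ha with ha | ha
  · rw [ha, h0]
  · rw [ha, h0, neg_zero]

/-- [folklore] First letters of a pair-indicator list vanish off the bond region of the first bond. -/
theorem fst_eq_zero_of_lettersInB {P : Fin d → (Fin d → ℤ) → Prop} {f f' : Bond d} (hf : ¬ P f.1 f.2) {l : List (ℤ × ℤ)}
    (h : (∀ a ∈ l, ∃ κ₀ x₀, P κ₀ x₀ ∧ (a = (pairForm (δ1 f) (δ1 f')) κ₀ x₀ ∨ a = -(pairForm (δ1 f) (δ1 f')) κ₀ x₀))) : ∀ p ∈ l, p.1 = 0 := by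
  intro p hp
  obtain ⟨κ, x, hx, hp⟩ := h p hp
  have h0 : δ1 f κ x = 0 := by
    rw [δ1_apply, if_neg]
    rintro rfl
    exact hf hx
  rcases hp with hp | hp
  · rw [hp, pairForm_apply, h0]
  · rw [hp, pairForm_apply, h0, Prod.neg_mk, neg_zero]

/-- [folklore] `q¹` VANISHES OFF THE SHARP REGION (in-block root). -/
theorem linCountAt_eq_zero_of_not_inSupp {L : ℕ} {μ : Fin d} {y : Fin d → ℤ} {r : Fin d → ℕ} (hr : r ∈ box d L) {f : Bond d}
    (h : ¬ (fun (κ : Fin _) (x' : Fin _ → ℤ) => x' κ ≤ (L : ℤ) * y κ + ((L : ℤ) - 2) + (if κ = μ then (L : ℤ) else 0)) f.1 f.2) : linCountAt (toSite r) L μ y f = 0 :=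
  Finset.sum_eq_zero fun _ hb => sum_eq_zero_of_lettersInB h (lettersInB_gammaCAt _ L μ y hr hb)

/-- [folklore] The coarse-bond count VANISHES OFF THE SHARP REGION (in-block root). -/
theorem cCountAt_eq_zero_of_not_inSupp {L : ℕ} {μ : Fin d} {y : Fin d → ℤ} {r : Fin d → ℕ} (hr : r ∈ box d L) {f : Bond d}
    (h : ¬ (fun (κ : Fin _) (x' : Fin _ → ℤ) => x' κ ≤ (L : ℤ) * y κ + ((L : ℤ) - 2) + (if κ = μ then (L : ℤ) else 0)) f.1 f.2) : cCountAt (toSite r) L μ y f = 0 :=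
  sum_eq_zero_of_lettersInB h (lettersInB_cSegAt _ L μ y hr)

/-- [folklore] **`h^ρ` VANISHES WHEN THE FIRST BOND IS OFF THE SHARP REGION** (in-block root): no rooted contour of the coarse bond `(μ, y)` passes through a transverse
bond reaching a block face, nor through a `μ`-bond reaching the far face of the support box. -/
theorem hessCountAt_eq_zero_of_not_inSupp_left {L : ℕ} {μ : Fin d} {y : Fin d → ℤ} {r : Fin d → ℕ} (hr : r ∈ box d L)
    {f : Bond d} (h : ¬ (fun (κ : Fin _) (x' : Fin _ → ℤ) => x' κ ≤ (L : ℤ) * y κ + ((L : ℤ) - 2) + (if κ = μ then (L : ℤ) else 0)) f.1 f.2) (f' : Bond d) : hessCountAt (toSite r) L μ y f f' = 0 := by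
  have h1 : ∀ b ∈ box d L, wedge (loopCAt (toSite r) (pairForm (δ1 f) (δ1 f')) L μ y b) = 0 := fun b hb =>
    wedge_eq_zero_of_fst _ (fst_eq_zero_of_lettersInB h (lettersInB_loopCAt _ L μ y hr hb))
  have h2 : wedge (segUp (pairForm (δ1 f) (δ1 f')) ((L : ℤ) • y + toSite r) μ L) = 0 :=
    wedge_eq_zero_of_fst _ (fst_eq_zero_of_lettersInB h (lettersInB_cSegAt _ L μ y hr))
  rw [hessCountAt, Finset.sum_eq_zero h1, h2, linCountAt_eq_zero_of_not_inSupp hr h, cCountAt_eq_zero_of_not_inSupp hr h]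
  ring

/-- [folklore] `h^ρ` vanishes when the SECOND bond is off the sharp region (antisymmetry). -/
theorem hessCountAt_eq_zero_of_not_inSupp_right {L : ℕ} {μ : Fin d} {y : Fin d → ℤ} {r : Fin d → ℕ} (hr : r ∈ box d L)
    (f : Bond d) {f' : Bond d} (h : ¬ (fun (κ : Fin _) (x' : Fin _ → ℤ) => x' κ ≤ (L : ℤ) * y κ + ((L : ℤ) - 2) + (if κ = μ then (L : ℤ) else 0)) f'.1 f'.2) : hessCountAt (toSite r) L μ y f f' = 0 := by
  rw [← neg_neg (hessCountAt (toSite r) L μ y f f'), ← hessCountAt_swap, hessCountAt_eq_zero_of_not_inSupp_left hr h, neg_zero]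

/-- [folklore] The normalised kernel: `hessKerAt = 0` off the sharp region, first bond. -/
theorem hessKerAt_eq_zero_of_not_inSupp_left {L : ℕ} {μ : Fin d} {y : Fin d → ℤ} {r : Fin d → ℕ} (hr : r ∈ box d L)
    {f : Bond d} (h : ¬ (fun (κ : Fin _) (x' : Fin _ → ℤ) => x' κ ≤ (L : ℤ) * y κ + ((L : ℤ) - 2) + (if κ = μ then (L : ℤ) else 0)) f.1 f.2) (f' : Bond d) : hessKerAt (toSite r) L μ y f f' = 0 := by
  rw [hessKerAt, hessCountAt_eq_zero_of_not_inSupp_left hr h, Int.cast_zero, zero_div]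

/-- [folklore] The normalised kernel: `hessKerAt = 0` off the sharp region, second bond. -/
theorem hessKerAt_eq_zero_of_not_inSupp_right {L : ℕ} {μ : Fin d} {y : Fin d → ℤ} {r : Fin d → ℕ} (hr : r ∈ box d L)
    (f : Bond d) {f' : Bond d} (h : ¬ (fun (κ : Fin _) (x' : Fin _ → ℤ) => x' κ ≤ (L : ℤ) * y κ + ((L : ℤ) - 2) + (if κ = μ then (L : ℤ) else 0)) f'.1 f'.2) : hessKerAt (toSite r) L μ y f f' = 0 := by
  rw [hessKerAt, hessCountAt_eq_zero_of_not_inSupp_right hr f h, Int.cast_zero, zero_div]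

/-- [folklore] **AN ANTISYMMETRIC KERNEL SUMS TO ZERO ON A SQUARE**: `Σ_{q,u ∈ T} h^ρ((κ,q),(κ,u)) = 0`. -/
theorem sum_sum_hessKerAt_eq_zero {D : ℕ} (ρ : Fin D → ℤ) (L : ℕ) (μ κ : Fin D) (y : Fin D → ℤ) (T : Finset (Fin D → ℤ)) :
    ∑ q ∈ T, ∑ u ∈ T, hessKerAt ρ L μ y (κ, q) (κ, u) = 0 := by
  have h := Finset.sum_comm (s := T) (t := T) (f := fun q u => hessKerAt ρ L μ y (κ, q) (κ, u))
  have e : ∑ u ∈ T, ∑ q ∈ T, hessKerAt ρ L μ y (κ, q) (κ, u) = -∑ u ∈ T, ∑ q ∈ T, hessKerAt ρ L μ y (κ, u) (κ, q) := by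
    rw [← Finset.sum_neg_distrib]
    refine Finset.sum_congr rfl fun u _ => ?_
    rw [← Finset.sum_neg_distrib]
    exact Finset.sum_congr rfl fun q _ => hessKerAt_swap ρ L μ y (κ, u) (κ, q)
  rw [e] at h
  linarith

end Kernel

/-! ## §3 Face-supported data on both legs: the additive-chart letter vanishes -/

section Face

/-- [folklore] A face-supported profile read at a coordinate of a point of the support box is nonzero only at the two face heights `L·y_β + L − 1`, `L·y_β + 2L − 1`. -/
theorem face_heights {L : ℕ} (hL : 1 ≤ L) {g : ℤ → ℝ} (hg : ∀ n : ℤ, n % (L : ℤ) ≠ (L : ℤ) - 1 → g n = 0) {y q : Fin (d + 1) → ℤ}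
    (hq : Near L y q) (β : Fin (d + 1)) (hne : g (q β) ≠ 0) :
    q β = (L : ℤ) * y β + ((L : ℤ) - 1) ∨ q β = (L : ℤ) * y β + (2 * (L : ℤ) - 1) := by
  have hmod : q β % (L : ℤ) = (L : ℤ) - 1 := by
    by_contra hc
    exact hne (hg _ hc)
  obtain ⟨h1, h2⟩ := hq β
  have hL' : (0 : ℤ) < L := by exact_mod_cast hL
  have e : (q β - (L : ℤ) * y β) % (L : ℤ) = (L : ℤ) - 1 := by
    rw [show q β - (L : ℤ) * y β = q β + (L : ℤ) * (-y β) by ring, Int.add_mul_emod_self_left, hmod]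
  have hw := (Summit.QuantumFields.BalabanUV.Beta.GAN24.VHClassCurrentSym.emod_window (L := (L : ℤ)) (n := q β - (L : ℤ) * y β)
    (by omega) (by omega)).1 e
  omega

/-- [folklore] **THE ROOTED HESSIAN KERNEL AGAINST TWO FACE-SUPPORTED SINGLE-COORDINATE DATA VANISHES** (finite form on the support box):
`Σ_{q,u ∈ nearBox L y} h(q_β)s(u_ν)·h^ρ_{(m,y)}((β,q),(ν,u)) = 0` — transverse face bonds and far-face bonds are off the sharp region (§2); what is left is
`β = ν = m` at the one near face height, a square of an antisymmetric kernel. -/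
theorem sum_nearBox_faceData_hessKerAt_eq_zero {L : ℕ} (hL : 1 ≤ L) {r : Fin (d + 1) → ℕ} (hr : r ∈ box (d + 1) L) (β ν m : Fin (d + 1))
    (y : Site (d + 1)) {h s : ℤ → ℝ} (hh : ∀ n : ℤ, n % (L : ℤ) ≠ (L : ℤ) - 1 → h n = 0) (hs : ∀ n : ℤ, n % (L : ℤ) ≠ (L : ℤ) - 1 → s n = 0) :
    ∑ q ∈ nearBox L y, ∑ u ∈ nearBox L y, h (q β) * s (u ν) * hessKerAt (toSite r) L m y (β, q) (ν, u) = 0 := by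
  classical
  -- a weighted term survives only at the near face height of the coarse direction
  have key : ∀ (g : ℤ → ℝ) (κ : Fin (d + 1)), (∀ n : ℤ, n % (L : ℤ) ≠ (L : ℤ) - 1 → g n = 0) → ∀ q ∈ nearBox L y,
      g (q κ) ≠ 0 → (fun (κ : Fin _) (x' : Fin _ → ℤ) => x' κ ≤ (L : ℤ) * y κ + ((L : ℤ) - 2) + (if κ = m then (L : ℤ) else 0)) κ q → κ = m ∧ q κ = (L : ℤ) * y κ + ((L : ℤ) - 1) := by
    intro g κ hg q hq hne hin
    have hq' : Near L y q := mem_nearBox.1 hq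
    beta_reduce at hin
    rcases face_heights hL hg hq' κ hne with e | e <;> split_ifs at hin with hκ <;> first | exact ⟨hκ, by omega⟩ | (exfalso; omega)
  by_cases hβ : β = m
  · by_cases hν : ν = m
    · rw [hβ, hν]
      set H : ℤ := (L : ℤ) * y m + ((L : ℤ) - 1) with hH
      -- restrict both sums to the near face height
      have e1 : ∑ q ∈ nearBox L y, ∑ u ∈ nearBox L y, h (q m) * s (u m) * hessKerAt (toSite r) L m y (m, q) (m, u) =
          ∑ q ∈ (nearBox L y).filter (fun q => q m = H), ∑ u ∈ (nearBox L y).filter (fun u => u m = H), h H * s H * hessKerAt (toSite r) L m y (m, q) (m, u) := by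
        rw [Finset.sum_filter]
        refine Finset.sum_congr rfl fun q hq => ?_
        by_cases hqH : q m = H
        · rw [if_pos hqH, Finset.sum_filter]
          refine Finset.sum_congr rfl fun u hu => ?_
          by_cases huH : u m = H
          · rw [if_pos huH, hqH, huH]
          · rw [if_neg huH]
            by_cases hsu : s (u m) = 0
            · rw [hsu, mul_zero, zero_mul]
            · have hnin : ¬ (fun (κ : Fin _) (x' : Fin _ → ℤ) => x' κ ≤ (L : ℤ) * y κ + ((L : ℤ) - 2) + (if κ = m then (L : ℤ) else 0)) m u := fun hin => huH (key s m hs u hu hsu hin).2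
              rw [hessKerAt_eq_zero_of_not_inSupp_right hr _ (f' := (m, u)) hnin, mul_zero]
        · rw [if_neg hqH]
          refine Finset.sum_eq_zero fun u _ => ?_
          by_cases hhq : h (q m) = 0
          · rw [hhq, zero_mul, zero_mul]
          · have hnin : ¬ (fun (κ : Fin _) (x' : Fin _ → ℤ) => x' κ ≤ (L : ℤ) * y κ + ((L : ℤ) - 2) + (if κ = m then (L : ℤ) else 0)) m q := fun hin => hqH (key h m hh q hq hhq hin).2
            rw [hessKerAt_eq_zero_of_not_inSupp_left hr (f := (m, q)) hnin, mul_zero]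
      rw [e1]
      simp_rw [← Finset.mul_sum]
      rw [sum_sum_hessKerAt_eq_zero, mul_zero]
    · -- ν ≠ m: every weighted second bond is off the sharp region
      refine Finset.sum_eq_zero fun q _ => Finset.sum_eq_zero fun u hu => ?_
      by_cases hsu : s (u ν) = 0
      · rw [hsu, mul_zero, zero_mul]
      · have hnin : ¬ (fun (κ : Fin _) (x' : Fin _ → ℤ) => x' κ ≤ (L : ℤ) * y κ + ((L : ℤ) - 2) + (if κ = m then (L : ℤ) else 0)) ν u := fun hin => hν (key s ν hs u hu hsu hin).1
        rw [hessKerAt_eq_zero_of_not_inSupp_right hr _ (f' := (ν, u)) hnin, mul_zero]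
  · -- β ≠ m: every weighted first bond is off the sharp region
    refine Finset.sum_eq_zero fun q hq => Finset.sum_eq_zero fun u _ => ?_
    by_cases hhq : h (q β) = 0
    · rw [hhq, zero_mul, zero_mul]
    · have hnin : ¬ (fun (κ : Fin _) (x' : Fin _ → ℤ) => x' κ ≤ (L : ℤ) * y κ + ((L : ℤ) - 2) + (if κ = m then (L : ℤ) else 0)) β q := fun hin => hβ (key h β hh q hq hhq hin).1
      rw [hessKerAt_eq_zero_of_not_inSupp_left hr (f := (β, q)) hnin, mul_zero]

end Face

/-! ## §4 The additive-chart letter: every free leg -/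

section Letter

/-- [folklore] **THE ADDITIVE-CHART BORDER LETTER AGAINST FACE DATA ON BOTH LEGS VANISHES (weighted leg first, free leg second)**: for exit-face-supported
single-coordinate data `h` (direction `β`, field leg) and `s` (direction `ν`, slot leg), `1 ≤ L`, `r ∈ box L`, every free leg `(p, a)`:
`Σ'_q h(q_β)·Σ'_u s(u_ν)·vhSaddAt ρ d L ν u q p (inl β) a = 0`. -/
theorem vhSaddAt_faceData_eq_zero {L : ℕ} (hL : 1 ≤ L) {r : Fin (d + 1) → ℕ} (hr : r ∈ box (d + 1) L) (ν β : Fin (d + 1))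
    {h s : ℤ → ℝ} (hh : ∀ n : ℤ, n % (L : ℤ) ≠ (L : ℤ) - 1 → h n = 0) (hs : ∀ n : ℤ, n % (L : ℤ) ≠ (L : ℤ) - 1 → s n = 0)
    (p : Site (d + 1)) (a : Fib d) :
    ∑' q : Site (d + 1), h (q β) * ∑' u : Site (d + 1), s (u ν) * vhSaddAt (toSite r) d L rfl ν u q p (Sum.inl β) a = 0 := by
  classical
  rcases a with α | m
  · simp [vhSaddAt]
  · by_cases hp : off L p = 0
    · simp only [vhSaddAt, packVH_inl_inr, if_pos hp]
      set y := blk L p with hy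
      have hout : ∀ q : Site (d + 1), ¬ Near L y q → ∀ u, hessKerAt (toSite r) L m y (β, q) (ν, u) = 0 := fun q hq u =>
        hessKerAt_eq_zero_left hr (f := (β, q)) hq _
      have hin : ∀ (q : Site (d + 1)),
          ∑' u : Site (d + 1), s (u ν) * hessKerAt (toSite r) L m y (β, q) (ν, u) = ∑ u ∈ nearBox L y, s (u ν) * hessKerAt (toSite r) L m y (β, q) (ν, u) := by
        intro q
        refine tsum_eq_sum fun u hu => ?_
        rw [hessKerAt_eq_zero_right hr _ (f' := (ν, u)) (fun hn => hu (mem_nearBox.2 hn)), mul_zero]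
      simp_rw [hin]
      rw [tsum_eq_sum (s := nearBox L y) fun q hq => by
        rw [Finset.sum_eq_zero fun u _ => by rw [hout q (fun hn => hq (mem_nearBox.2 hn)) u, mul_zero], mul_zero]]
      simp_rw [Finset.mul_sum]
      have e : ∑ q ∈ nearBox L y, ∑ u ∈ nearBox L y, h (q β) * (s (u ν) * hessKerAt (toSite r) L m y (β, q) (ν, u)) =
          ∑ q ∈ nearBox L y, ∑ u ∈ nearBox L y, h (q β) * s (u ν) * hessKerAt (toSite r) L m y (β, q) (ν, u) :=
        Finset.sum_congr rfl fun q _ => Finset.sum_congr rfl fun u _ => by ring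
      rw [e, sum_nearBox_faceData_hessKerAt_eq_zero hL hr β ν m y hh hs]
    · simp only [vhSaddAt, packVH_inl_inr, if_neg hp, mul_zero, tsum_zero]

/-- [folklore] **THE ADDITIVE-CHART BORDER LETTER AGAINST FACE DATA ON BOTH LEGS VANISHES (free leg first, weighted leg second)** (`vhSaddAt_symm`). -/
theorem vhSaddAt_faceData_eq_zero' {L : ℕ} (hL : 1 ≤ L) {r : Fin (d + 1) → ℕ} (hr : r ∈ box (d + 1) L) (ν β : Fin (d + 1))
    {h s : ℤ → ℝ} (hh : ∀ n : ℤ, n % (L : ℤ) ≠ (L : ℤ) - 1 → h n = 0) (hs : ∀ n : ℤ, n % (L : ℤ) ≠ (L : ℤ) - 1 → s n = 0)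
    (p : Site (d + 1)) (a : Fib d) :
    ∑' q : Site (d + 1), h (q β) * ∑' u : Site (d + 1), s (u ν) * vhSaddAt (toSite r) d L rfl ν u p q a (Sum.inl β) = 0 := by
  have e : ∀ (u q : Site (d + 1)), vhSaddAt (toSite r) d L rfl ν u p q a (Sum.inl β) = vhSaddAt (toSite r) d L rfl ν u q p (Sum.inl β) a :=
    fun u q => vhSaddAt_symm (toSite r) L ν u p q a (Sum.inl β)
  simp_rw [e]
  exact vhSaddAt_faceData_eq_zero hL hr ν β hh hs p a

end Letter

end Summit.QuantumFields.BalabanUV.Beta.GAN24.FaceDataHessNull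

end
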